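import Mathlib.Data.Nat.Notation
import Mathlib.Data.Int.Notation
import HarnessLib

/-!
# Kurihara-number certificate records — the record schema and its in-kernel recheck

Topic `NumberTheory/EllipticCurves`; namespace `Literature.NumberTheory.EllipticCurves.KuriharaCertificates`
(= this directory).  This file fixes the FORMAT in which computed mod-`p` Kurihara numbers are entered into
the tree as data records, one kernel-checked theorem per curve, in the sibling files `Records*.lean` of this
directory (generated; each states `Certified [r₁, …, r_k]` for the records `rᵢ` of one Cremona curve and is
proved by `decide`, i.e. by the kernel re-running `Record.nonvanishing` on the literal data).  Nothing here is
a named fact and nothing is asserted about elliptic curves: a record is DATA together with a decidable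
well-formedness predicate; what a record means for the curve, in the vocabulary of
`Literature.NumberTheory.EllipticCurves.kuriharaNumber`, is spelled out in the sibling file `Claim.lean`
(`Record.Claim`, a `Prop` to be taken as a hypothesis, D-0014 style) and summarised below.

## What a record records (C.-H. Kim, arXiv:2203.12159 = Amer. J. Math., §1.4.1–§1.4.3, PDF p. 7;
M. Kurihara, Contrib. Math. Comput. Sci. 7 (2014), §1.1; F. Castella, T. Sano, arXiv:2601.14504, §1.1.1)

For an elliptic curve `E/ℚ` of conductor `N` (Cremona label `label`, minimal a-invariants `ainvs`
`= [a₁, a₂, a₃, a₄, a₆]`), a prime `p` and a square-free product `n = ∏ primes` of KOLYVAGIN PRIMES `ℓ`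
(`ℓ ∤ Np`, `ℓ ≡ 1 (mod p)`, `a_ℓ(E) ≡ ℓ + 1 ≡ 2 (mod p)`; Kim's `𝒩₁`, §1.2.2), Kim's mod-`p` Kurihara number is
`δ̃_n = ∑_{a ∈ (ℤ/n)ˣ} \overline{[a/n]⁺} · ∏_{ℓ ∣ n} \overline{log_{η_ℓ}(a)} ∈ 𝔽_p`, where
`[r]⁺ = Re(∫_{i∞}^{r} 2πi f_E(z) dz)/Ω⁺_E` is the plus modular symbol of the newform `f_E` normalised by the
Néron period `Ω⁺_E = ∫_{E(ℝ)} |ω|` of a global minimal model (§1.4.1: "the real Néron period"), and `η_ℓ` is a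
primitive root mod `ℓ` (`δ̃_n` is well defined up to a unit of `𝔽_p`, §1.4.3; `ν(n)` = number of prime factors
of `n`; `δ̃_1 = [0]⁺ = L(E,1)/Ω⁺_E`).  A record stores, for one triple `(E, p, n)`:
`primes = [ℓ₁, …, ℓ_ν]`, `roots = [η_{ℓ₁}, …]` (the least primitive roots), `components = c_∞ ∈ {1, 2}` (the
number of connected components of `E(ℝ)`), `deltaModP ∈ [0, p)` = the computed residue of `δ̃_n`, `nu = ν(n)`,
`rank` = the Mordell–Weil rank from Cremona's tables, `reduction` ∈ {"good-ordinary", "good-supersingular",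
"split", "nonsplit", "additive"} (the type of `E` at `p`), `theorems` = short codes of the printed theorems the
computing seat attached to the record (documentation only), and the modular-symbol data it was computed from:
the engine evaluates `x⁺{∞, a/n} ∈ ℚ`, PARI/GP's `msfromell` plus-symbol of `E` (normalised by the least
positive real period `ω₁` of the Néron lattice, so that `[r]⁺ = x⁺{∞, r}/c_∞`), for `0 < a < n/2`, `(a, n) = 1`
— by `x⁺{∞, −r} = x⁺{∞, r}` and `log_{η_ℓ}(−1) = (ℓ−1)/2 ≡ 0 (mod p)` (`p` odd, `p ∣ ℓ − 1`) the full sum is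
twice the half sum — and either carries this half table INLINE as `symbols = [(a, num, den), …]`
(`x⁺{∞, a/n} = num/den`; for `n = 1` the single entry `(0, num, den)` with `x⁺{∞, 0} = num/den = c_∞ · L(E,1)/Ω⁺_E`),
or leaves `symbols = []`; in both cases `symSha256` is the SHA-256 of the exact table in the engine's text format
(file `sym/<label>_p<p>_n<n>.sym` of the job output; the generated files name the jobs).  When the table is
inline, `Record.consistent` RECOMPUTES `δ̃_n mod p` from it (`Record.deltaRecomputed`: exact rational
residues, discrete logarithms by enumeration) and demands agreement with `deltaModP`; this is what the kernel
re-runs when it checks a `Records*.lean` theorem by `decide`.  When it is not, the kernel checks only the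
shape conditions and the record is a statement-level entry pinned by its hash.

## Relation to the tree's `kuriharaNumber`

`Literature.NumberTheory.EllipticCurves.kuriharaNumber f p n ψ` (file `KuriharaNumber`) is the same sum with
the plus symbol normalised by the period `Ω⁺_f` of the newform's lattice (`ratPlusSymbol`) instead of `Ω⁺_E`, and
with arbitrary discrete logarithms `ψ_ℓ`.  Under the period-transfer hypothesis `Ω(W) = u · Ω⁺_f`, `|u|_p = 1`
of `Kim2022_kuriharaNumber_certificate` (file `KuriharaNumberKimCertificate`, module docstring, PERIODS) one
has `kuriharaNumber f p n (log_η mod p) = ū · δ̃_n` with `ū ∈ 𝔽_pˣ`, and non-vanishing does not depend on the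
choice of surjective `ψ_ℓ` (`exists_units_kuriharaNumber_eq_mul`); so a record with `deltaModP ≠ 0` CLAIMS
`kuriharaNumber D.f p n ψ ≠ 0` for the curve's parametrisation data `D` — this is `Record.Claim` of
`Claim.lean`.  The computation itself (PARI's `msfromell`, the engines and their cross-checks) is described with
the generated files; this file takes no position on it beyond the recheck above.

## Design

* Plain computable data (`ℕ`, `ℤ`, `String`, `List`), no `Mathlib` structures, so that a generated file of
  several hundred records elaborates in seconds and `decide` runs the recheck inside the kernel (no
  `native_decide`, no extra axioms).  The arithmetic helpers are the naive ones (`powMod` by repeated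
  multiplication, `dlog` by enumeration): tables are inlined only when small.
* `Certified rs` is a `Prop` with a `Decidable` instance; `Certified.nonvanishing_of_mem` etc. unpack it.
* The same schema is used verbatim by the computing fleet's out-of-tree chunk files (build `kurihara`), so the
  two formats are interchangeable record by record.

Not here: any statement about elliptic curves (see `Claim.lean`), primality or primitive-root checks of
`p`, `ℓ`, `η_ℓ` (the shape predicate checks `ℓ ≡ 1 (mod p)` only), the Kolyvagin condition `a_ℓ ≡ 2` (it needs
`a_ℓ(E)`, i.e. the curve — `Claim.lean`), and the data (files `Records*.lean`).

References: C.-H. Kim, arXiv:2203.12159, §1.2.2, §1.4.1–1.4.3, Thm. 1.11 [Kim2022StructureSelmer];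
M. Kurihara, *The structure of Selmer groups of elliptic curves and modular symbols* (2014), §1.1 [Kurihara2014];
F. Castella, T. Sano, arXiv:2601.14504 (2026), §1.1 [CastellaSano2026]; J. E. Cremona, ANTS VII (2006), the
elliptic curve database (labels, a-invariants, ranks) [Cremona2006].
-/

namespace Literature.NumberTheory.EllipticCurves.KuriharaCertificates

/-- One computed mod-`p` Kurihara number: the DATA of the computation of `δ̃_n (mod p)` for the curve `label`
at `(p, n)` (Kim 2022, §1.4.3), see the module docstring for the meaning of each field.  A record asserts
nothing by itself; `Record.consistent` / `Record.nonvanishing` are its decidable shape-and-recheck predicates.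
[cite: Kim2022StructureSelmer, §1.4.3 (PDF p. 7)] -/
structure Record where
  /-- Cremona label of the curve (e.g. `"11a1"`). -/
  label : String
  /-- a-invariants `[a₁, a₂, a₃, a₄, a₆]` of the (reduced) global minimal model. -/
  ainvs : List ℤ
  /-- the conductor `N`. -/
  conductor : ℕ
  /-- the prime `p` (the Kurihara number lives in `𝔽_p`). -/
  p : ℕ
  /-- the square-free level `n = ∏ primes` (`n = 1` allowed). -/
  n : ℕ
  /-- the Kolyvagin primes `ℓ ∣ n`, increasing. -/
  primes : List ℕ
  /-- `roots[i]` = the least primitive root `η_ℓ` modulo `primes[i]`. -/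
  roots : List ℕ
  /-- `c_∞` = number of connected components of `E(ℝ)` (`1` or `2`). -/
  components : ℕ
  /-- the computed residue of `δ̃_n` in `[0, p)`. -/
  deltaModP : ℕ
  /-- `ν(n)` = number of prime factors of `n`. -/
  nu : ℕ
  /-- Mordell–Weil rank of `E(ℚ)` (Cremona's tables). -/
  rank : ℕ
  /-- reduction type of `E` at `p`: `"good-ordinary"`, `"good-supersingular"`, `"split"`, `"nonsplit"`, `"additive"`. -/
  reduction : String
  /-- inline half symbol table `[(a, num, den), …]`, `x⁺{∞, a/n} = num/den` for `0 < a < n/2`, `(a, n) = 1`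
  (for `n = 1`: `[(0, num, den)]`, `x⁺{∞, 0} = num/den`); `[]` when not carried inline. -/
  symbols : List (ℕ × ℤ × ℕ)
  /-- SHA-256 (hex) of the exact symbol table in the engine's text format. -/
  symSha256 : String
  /-- short codes of printed theorems the computing seat attached (documentation only). -/
  theorems : List String
  deriving DecidableEq

/-- `b ^ e mod m` by `e` repeated multiplications (small exponents only; `m = 0` gives `b ^ e`). [folklore] -/
def powMod (b e m : ℕ) : ℕ := (List.range e).foldl (fun acc _ => acc * b % m) (1 % m)

/-- The inverse of `d` modulo a PRIME `p` by Fermat, `d^{p-2} mod p` (junk if `p` is not prime or `p ∣ d`).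
[folklore] -/
def invModPrime (p d : ℕ) : ℕ := powMod (d % p) (p - 2) p

/-- The discrete logarithm of `a` to the base `g` modulo `ℓ`: the least `k < ℓ` with `g ^ k ≡ a (mod ℓ)`, found
by enumeration, and `ℓ` if there is none (junk). [folklore] -/
def dlog (ℓ g a : ℕ) : ℕ :=
  ((List.range ℓ).foldl
    (fun (st : ℕ × ℕ × Bool) _ =>
      let (k, acc, found) := st
      if found then st else if acc = a % ℓ then (k, acc, true) else (k + 1, acc * g % ℓ, false))
    (0, 1 % ℓ, false)).1

/-- The residue in `[0, p)` of the rational number `num/den` modulo the prime `p` (requires `p ∤ den`; junk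
otherwise). [folklore] -/
def ratRes (p : ℕ) (num : ℤ) (den : ℕ) : ℕ := (num % (p : ℤ)).toNat * invModPrime p den % p

/-- `δ̃_n mod p` RECOMPUTED from an inline half symbol table (Kim 2022, §1.4.3):
`c_∞⁻¹ · 2 · ∑_{(a, num, den) ∈ symbols} (num/den) · ∏_i log_{roots[i]}(a mod primes[i]) (mod p)` for `n > 1`
(the factor `2` restores the full sum over `(ℤ/n)ˣ` from the half range `0 < a < n/2`), and
`c_∞⁻¹ · num/den (mod p)` for `n = 1` (`δ̃_1 = [0]⁺ = x⁺{∞,0}/c_∞`).  Meaningful only when `symbols` is the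
complete half table. [cite: Kim2022StructureSelmer, §1.4.3 (PDF p. 7)] -/
def Record.deltaRecomputed (r : Record) : ℕ :=
  let lg := r.primes.zip r.roots
  let s := r.symbols.foldl
    (fun acc (t : ℕ × ℤ × ℕ) =>
      let (a, num, den) := t
      acc + ratRes r.p num den * lg.foldl (fun w (ℓg : ℕ × ℕ) => w * dlog ℓg.1 ℓg.2 a % r.p) 1) 0
  if r.n = 1 then invModPrime r.p r.components * s % r.p
  else 2 * invModPrime r.p r.components * s % r.p

/-- Internal consistency of a record (decidable, `Bool`-valued): five a-invariants, `n = ∏ primes` with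
`primes` duplicate-free (so `n` is square-free once the `ℓ` are prime), `#primes = nu = #roots`,
`deltaModP < p`, every `ℓ ≡ 1 (mod p)`, `components ∈ {1, 2}`, every inline denominator prime to `p`, and —
when the symbol table is inline — the recomputation `Record.deltaRecomputed` agrees with `deltaModP`.
(Primality of `p` and of the `ℓ`, primitivity of the roots and the Kolyvagin congruence `a_ℓ ≡ 2 (mod p)` are
NOT checked here.) [folklore] -/
def Record.consistent (r : Record) : Bool :=
  (r.ainvs.length == 5) &&
  (r.primes.foldl (· * ·) 1 == r.n) && (r.primes.length == r.nu) && (r.roots.length == r.nu) &&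
  r.primes.Nodup && (r.deltaModP < r.p) && r.primes.all (fun ℓ => ℓ % r.p == 1) &&
  (r.components == 1 || r.components == 2) &&
  r.symbols.all (fun t => t.2.2 % r.p != 0) &&
  (r.symbols.isEmpty || r.deltaRecomputed == r.deltaModP)

/-- A record is a NON-VANISHING CERTIFICATE when it is consistent and `deltaModP ≠ 0`, i.e. it records
`δ̃_n ≢ 0 (mod p)`. [folklore] -/
def Record.nonvanishing (r : Record) : Bool := r.consistent && (0 < r.deltaModP)

/-- A list of records is `Certified` when every one of them is a non-vanishing certificate.  This is the
statement of each generated per-curve theorem `theorem cert_<label> : Certified [ … ] := by decide` of the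
files `Records*.lean`. [folklore] -/
def Certified (rs : List Record) : Prop := rs.all Record.nonvanishing = true

/-- `Certified rs` is decidable (it is a `Bool` equation), so `decide` proves or refutes it on literals.
[folklore] -/
instance Certified.instDecidable (rs : List Record) : Decidable (Certified rs) :=
  inferInstanceAs (Decidable (rs.all Record.nonvanishing = true))

/-- Unpacking `Certified`: every listed record is a non-vanishing certificate. [folklore] -/
theorem Certified.nonvanishing_of_mem {rs : List Record} (h : Certified rs) {r : Record} (hr : r ∈ rs) :
    r.nonvanishing = true :=
  List.all_eq_true.1 h r hr

/-- Unpacking `Certified`: every listed record is consistent. [folklore] -/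
theorem Certified.consistent_of_mem {rs : List Record} (h : Certified rs) {r : Record} (hr : r ∈ rs) :
    r.consistent = true := by
  have := h.nonvanishing_of_mem hr
  simp only [Record.nonvanishing, Bool.and_eq_true] at this
  exact this.1

/-- Unpacking `Certified`: every listed record has `0 < deltaModP < p`. [folklore] -/
theorem Certified.deltaModP_pos_of_mem {rs : List Record} (h : Certified rs) {r : Record} (hr : r ∈ rs) :
    0 < r.deltaModP ∧ r.deltaModP < r.p := by
  have := h.nonvanishing_of_mem hr
  simp only [Record.nonvanishing, Record.consistent, Bool.and_eq_true, decide_eq_true_eq] at this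
  exact ⟨this.2, this.1.1.1.1.1.2⟩

/-- `Certified` is monotone under sublists: in particular it passes to `cons`-tails and to members of an
`append`. [folklore] -/
theorem Certified.cons_iff (r : Record) (rs : List Record) :
    Certified (r :: rs) ↔ r.nonvanishing = true ∧ Certified rs := by
  simp [Certified, List.all_cons]

/-- `Certified` of a concatenation is `Certified` of both parts. [folklore] -/
theorem Certified.append_iff (rs rs' : List Record) :
    Certified (rs ++ rs') ↔ Certified rs ∧ Certified rs' := by
  simp [Certified, List.all_append]

/-- The empty list is certified (vacuously). [folklore] -/
theorem Certified.nil : Certified [] := by decide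

/-- SAMPLE (and regression test of the recheck): the two `n = 1` records of `11a1` at `p = 7, 13`
(`x⁺{∞,0} = 1/5 = L(E,1)/Ω_E`, `c_∞ = 1`, so `δ̃_1 ≡ 5⁻¹ ≡ 3 (mod 7)` and `≡ 8 (mod 13)`), and one `ν = 1`
record of `37a1` (rank `1`) at `p = 11`, `n = ℓ = 23` (`a₂₃ = 2`), `η₂₃ = 5`, with its inline half table, are certified;
the kernel recomputes all three residues. [cite: Kim2022StructureSelmer, §1.4.3 (PDF p. 7)] -/
theorem certified_sample : Certified [
  { label := "11a1", ainvs := [0, -1, 1, -10, -20], conductor := 11, p := 7, n := 1, primes := [],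
    roots := [], components := 1, deltaModP := 3, nu := 0, rank := 0, reduction := "good-ordinary",
    symbols := [(0, 1, 5)],
    symSha256 := "6819cff6d90dffeb52b90a4a44d1660bdaac2bbf44e8ba64436dd146a17b6098", theorems := [] },
  { label := "11a1", ainvs := [0, -1, 1, -10, -20], conductor := 11, p := 13, n := 1, primes := [],
    roots := [], components := 1, deltaModP := 8, nu := 0, rank := 0, reduction := "good-ordinary",
    symbols := [(0, 1, 5)],
    symSha256 := "6819cff6d90dffeb52b90a4a44d1660bdaac2bbf44e8ba64436dd146a17b6098", theorems := [] },
  { label := "37a1", ainvs := [0, 0, 1, -1, 0], conductor := 37, p := 11, n := 23, primes := [23],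
    roots := [5], components := 2, deltaModP := 8, nu := 1, rank := 1, reduction := "good-ordinary",
    symbols := [(1, -1, 1), (2, 1, 1), (3, 1, 1), (4, 0, 1), (5, 1, 1), (6, -1, 1), (7, 0, 1), (8, 0, 1),
      (9, -1, 1), (10, -1, 1), (11, 1, 1)],
    symSha256 := "e7e9deabf0ae1189c9ceabfb9d576c33a6a2b8e21fd18e4335d9589c0029953c", theorems := [] } ] := by
  decide

/-- Tampering is caught: the first sample record with `deltaModP` changed from `3` to `4` is NOT certified
(the kernel recomputation gives `3`). [folklore] -/
theorem not_certified_tampered : ¬ Certified [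
  { label := "11a1", ainvs := [0, -1, 1, -10, -20], conductor := 11, p := 7, n := 1, primes := [],
    roots := [], components := 1, deltaModP := 4, nu := 0, rank := 0, reduction := "good-ordinary",
    symbols := [(0, 1, 5)],
    symSha256 := "6819cff6d90dffeb52b90a4a44d1660bdaac2bbf44e8ba64436dd146a17b6098", theorems := [] } ] := by
  decide

end Literature.NumberTheory.EllipticCurves.KuriharaCertificates
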